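import Summits.QuantumFields.BalabanUV.Beta.GAN24.T2RecSourceRows
import Summits.QuantumFields.BalabanUV.Beta.GAN24.SrecAtSlotRowsFinal
import Summits.QuantumFields.BalabanUV.Beta.GAN24.LegDriftRowsOfLegChain
import Summits.QuantumFields.BalabanUV.Beta.GAN24.LegFirstWindowRows
import Summits.QuantumFields.BalabanUV.Beta.GAN24.HalfMemberSlavedDivergenceDrift

/-!
# `BalabanUV.Beta.GAN24.LegSourceRowsThree` — binder row G-an2-4 ∕ (CONV-C), W-slot, the (α-0) parity re-cut, row L11 (Q-L): **THE SOURCE ROWS (HS) ∕ (HS′) AND THE INITIAL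
# MEMBER's ROW (Hx0) OF THE WINDOW DISPLAY ARE THEOREMS AT `d = 3`** — the per-level `LocStencil₂` row of the `ε`-member's source leg letter `rdiv ∘ F^ε_n`, its geometric
# source-drift row, and the row of `rdiv ∘ y_0`, ALL AT ONE COMMON POSITIVE RATE, hypothesis-free at the pin `cE = Lc⁴` (every `cVH cΛ cE₂ cB`, every in-block root, any
# `LocStencil₂` border, `|ε| ≤ 1`) (G-an2-4 formalisation swarm, leaf prover `b2b-balaban-gan24-formalise-leaf-03`, gen 68; FILE 6 of the journal INTENT [LEAF03-G68-ONLINE]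
# «(H2) ⟸ THE SAME WINDOWS»; supplies three displayed rows of MY FILE 4 `LegRowsOfWindows` ∕ FILE 5 `WrecAtEvenHalfRowsOfWindows` BY NAME from p2 g35's (F4) socket
# `T2RecSourceRows.source_rows_three_of_srecAt_rows` and the OWNER ∕ leaf lineages' UNCONDITIONAL S-slot rows `SrecAtSlotRowsFinal.exists_hS_hSall_SrecAt_three`)

NOT IN PRINT; OUR BOOKKEEPING ([folklore] composition BY NAME; 0 `def`, 0 cited facts, 0 `def … : Prop`, 0 sorry).  HONEST FRAMING (cell contract, verbatim): «discharging
`BetaPertH` makes Bałaban's UV stability UNCONDITIONAL — a real constructive-QFT result; it is NOT the continuum limit and NOT the Clay problem.»  HONEST DEPENDENCY (verbatim):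
«continuum YM on T⁴ ⇐ BetaPertH ∧ nine spine estimates (0/9 proved); BetaPertH ⇐ (D1) ∧ (D4) ∧ CAP+tail; G-an2-4 gates asym, D1 and NE2/3/4.»

WHAT (`d = 3`, `2 ≤ Lc`, `cE = Lc⁴`): **`exists_halfSource_rows_three`** — `∃ δS > 0, ∃ C_F c_F θ_F C₀, 0 ≤ θ_F < 1 ∧ (∀ n, LocStencil₂ (rdiv ∘ F^ε_n) C_F δS) ∧
(∀ l, LocStencil₂ (rdiv ∘ F^ε_{l+1} − rdiv ∘ F^ε_l) (c_F·θ_F^l) δS) ∧ LocStencil₂ (rdiv ∘ y_0) C₀ δS` where `F^ε_n = ½•(b̃_n + ε•P b̃_n)` is the `ε`-member's source and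
`y_0 = ½•(T̃_0 + ε•P T̃_0)` its level-0 member (the letters of MY FILE 4's (HS) ∕ (HS′) ∕ (Hx0), `GoodLS`-rows apart).  HOW: the raw rows `LocStencil₂ b̃_j Cb δb` and
`LocStencil₂ (b̃_{k+j} − b̃_k) (cb·θb^k) δb′` are p2's `source_rows_three_of_srecAt_rows` fed with the unconditional comb S-slot rows `exists_hS_hSall_SrecAt_three`; then the
OWNER's `locStencil₂_half` ⨾ MY FILE 6 (g67) `locStencil₂_rdiv` (shape), leaf-01 g72's `half_sub` ⨾ MY `rdiv_comp_sub` (drift), leaf-01's `exists_locStencil₂_unitS₂_T2RecAt` at level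
`0` (initial member); one common rate by `LocStencil₂.mono`.  Imports the TREE only (all built).  (HSL) ∕ (HSL′) ∕ (HxL0) — the `GoodLS` (slot-charge ∕ divergence) rows of the same
three letters — are NOT here (they are the window supplier's currency).  Discharges NOTHING of (Q-L) ∕ (H1♮) ∕ (C)sym; NEVER «G-an2-4 closed» as (CONV-C); NOT D1, NOT `BetaPertH`,
NOT continuum, NOT Clay; not in print.  Unit `b2b-balaban-gan24-formalise-leaf-03` (gen 68), 2026-08-23.
-/

noncomputable section
open Finset
open scoped BigOperators
open Literature.MathematicalPhysics.QuantumFieldTheory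
open Literature.MathematicalPhysics.QuantumFieldTheory.Balaban1983to89
open Literature.MathematicalPhysics.QuantumFieldTheory.Balaban1983to89.Beta
open ExpKernelCalculus (MKer Site Decays shiftK)
open OneStepResolventKernel (Fib LocStencil)
open OneStepKernelFamily (KInvStep)
open AffineAveraging (box toSite unitVec)
open AveragingMixedJetTables (mixFFAt)
open SecondOrderResponse (W2SymOfK)
open BalabanCompositeJets (LocStencil₂ LocStencil₂.mono)
open BalabanStepJetsSucc (mmRead)
open BalabanStepW2 (K3OfK M2Of)
open Summit.QuantumFields.BalabanUV.Beta.TameKernelCalculus (trK)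
open Summit.QuantumFields.BalabanUV.Beta.BorderedHessian (sgnK)
open Summit.QuantumFields.BalabanUV.Beta.HessKerDressedUnits (unitK unitS)
open Summit.QuantumFields.BalabanUV.Beta.SecondOrderUnits (unitM unitS₂ unitM₂)
open Summit.QuantumFields.BalabanUV.Beta.AxialDressingRooted (coDressKBmAt)
open Summit.QuantumFields.BalabanUV.Beta.SpineRooted (T2RecAt SpureRecAt M1At)
open Summit.QuantumFields.BalabanUV.Beta.WardLocusRecursive (SrecAt)
open Summit.QuantumFields.BalabanUV.Beta.GAN24.CombesThomas (sfStep smStep)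
open Summit.QuantumFields.BalabanUV.Beta.GAN24.Lin4LegTower (rdiv)
open Summit.QuantumFields.BalabanUV.Beta.GAN24.T2HybridCellsComb (exists_locStencil₂_unitS₂_T2RecAt)
open Summit.QuantumFields.BalabanUV.Beta.GAN24.BiTableParityHalves (locStencil₂_half)
open Summit.QuantumFields.BalabanUV.Beta.GAN24.LegFirstWindowRows (locStencil₂_rdiv)
open Summit.QuantumFields.BalabanUV.Beta.GAN24.LegDriftRowsOfLegChain (rdiv_comp_sub)
open Summit.QuantumFields.BalabanUV.Beta.GAN24.HalfMemberSlavedDivergenceDrift (half_sub)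
open Summit.QuantumFields.BalabanUV.Beta.GAN24.T2RecSourceRows (source_rows_three_of_srecAt_rows)
open Summit.QuantumFields.BalabanUV.Beta.GAN24.SrecAtSlotRowsFinal (exists_hS_hSall_SrecAt_three)
open Summit.QuantumFields.BalabanUV.Beta.GAN24.WSlotT2OfPieces (locStencil₂_mono)

namespace Summit.QuantumFields.BalabanUV.Beta.GAN24.LegSourceRowsThree

variable {Lc : ℕ} [NeZero Lc] {r : Fin (3 + 1) → ℕ}

/-- NOT IN PRINT; OUR BOOKKEEPING.  **(HS), (HS′) AND (Hx0) OF THE WINDOW DISPLAY ARE THEOREMS AT `d = 3`, AT ONE COMMON RATE** (`2 ≤ Lc`, pin `cE = Lc⁴`, every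
`cVH cΛ cE₂ cB`, every in-block root `r`, any `LocStencil₂` border `vh₂S`, `|ε| ≤ 1`): the `ε`-member's source leg letters `rdiv ∘ F^ε_n` are `LocStencil₂` uniformly in the level,
their consecutive differences decay geometrically, and the level-0 member's leg letter `rdiv ∘ y_0` is `LocStencil₂` — p2's (F4) socket over the unconditional comb S-slot rows,
halved (the OWNER's `locStencil₂_half`, leaf-01's `half_sub`) and right-divergenced (MY `locStencil₂_rdiv`, `rdiv_comp_sub`); the rate is the minimum of the three. -/
theorem exists_halfSource_rows_three (hLc : 2 ≤ Lc) (hr : r ∈ box (3 + 1) Lc) {cE : ℝ} (hcE : cE = (Lc : ℝ) ^ (3 + 1)) (cVH cΛ cE₂ cB : ℝ)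
    (Tc : Fin 4 → Fin 4 → Fin 4 → Fin 4 → ℝ) {vh₂S : (Fin (3 + 1) → (Fin (3 + 1) → ℤ) → Fin (3 + 1) → (Fin (3 + 1) → ℤ) → MKer (3 + 1) (Fib 3))}
    (hB : ∃ C δ : ℝ, 0 < δ ∧ LocStencil₂ vh₂S C δ) {ε : ℝ} (hε : |ε| ≤ 1) :
    ∃ δS : ℝ, 0 < δS ∧ ∃ CF cF θF C₀ : ℝ, 0 ≤ θF ∧ θF < 1 ∧
      (∀ n, LocStencil₂ (fun κ u κ' u' => rdiv ((((1 : ℝ) / 2) • ((fun κ u κ' u' => (cE₂ * (Lc : ℝ) ^ (2 * (3 + 1))) • mmRead Lc (K3OfK (unitK (sfStep Lc n) (smStep 3 Lc n) (coDressKBmAt (toSite r) Lc (KInvStep (d := 3) Lc n))) Lc (unitS (sfStep Lc n) (smStep 3 Lc n) (SpureRecAt 3 Lc (toSite r) cE cVH cΛ n)) (unitM (sfStep Lc n) (smStep 3 Lc n) (M1At 3 Lc (toSite r) cΛ n)) (W2SymOfK (unitK (sfStep Lc n) (smStep 3 Lc n) (coDressKBmAt (toSite r) Lc (KInvStep (d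 := 3) Lc n))) Lc (unitS (sfStep Lc n) (smStep 3 Lc n) (SpureRecAt 3 Lc (toSite r) cE cVH cΛ n)) (unitM (sfStep Lc n) (smStep 3 Lc n) (M1At 3 Lc (toSite r) cΛ n)) 0 (unitM₂ (sfStep Lc n) (smStep 3 Lc n) (M2Of 3 Lc (mixFFAt (toSite r) Lc) n))) κ u κ' u') + cB • vh₂S κ u κ' u') + ε • fun κ u κ' u' => sgnK (trK (((fun κ u κ' u' => (cE₂ * (Lc : ℝ) ^ (2 * (3 + 1))) • mmRead Lc (K3OfK (unitK (sfStep Lc n) (smStep 3 Lc n) (coDressKBmAt (toSite r) Lc (KInvStep (d := 3) Lc n))) Lc (unitS (sfStep Lc n) (smStep 3 Lc n) (SpureRecAt 3 Lc (toSite r) cE cVH cΛ n)) (unitM (sfStep Lc n) (smStep 3 Lc n) (M1At 3 Lc (toSite r) cΛ n)) (W2SymOfK (unitK (sfStep Lc n) (smStep 3 Lc n) (coDressKBmAt (toSite r) Lc (KInvStep (d := 3) Lc n))) Lc (unitS (sfStep Lc n) (smStep 3 Lc n) (SpureRecAt 3 Lc (toSite r) cE cVH cΛ n)) (unitM (sfStep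 Lc n) (smStep 3 Lc n) (M1At 3 Lc (toSite r) cΛ n)) 0 (unitM₂ (sfStep Lc n) (smStep 3 Lc n) (M2Of 3 Lc (mixFFAt (toSite r) Lc) n))) κ u κ' u') + cB • vh₂S κ u κ' u')) κ u κ' u')))) κ u κ' u')) CF δS) ∧
      (∀ l, LocStencil₂ ((fun κ u κ' u' => rdiv ((((1 : ℝ) / 2) • ((fun κ u κ' u' => (cE₂ * (Lc : ℝ) ^ (2 * (3 + 1))) • mmRead Lc (K3OfK (unitK (sfStep Lc (l + 1)) (smStep 3 Lc (l + 1)) (coDressKBmAt (toSite r) Lc (KInvStep (d := 3) Lc (l + 1)))) Lc (unitS (sfStep Lc (l + 1)) (smStep 3 Lc (l + 1)) (SpureRecAt 3 Lc (toSite r) cE cVH cΛ (l + 1))) (unitM (sfStep Lc (l + 1)) (smStep 3 Lc (l + 1)) (M1At 3 Lc (toSite r) cΛ (l + 1))) (W2SymOfK (unitK (sfStep Lc (l + 1)) (smStep 3 Lc (l + 1)) (coDressKBmAt (toSite r) Lc (KInvStep (d := 3) Lc (l + 1)))) Lc (unitS (sfStep Lc (l + 1)) (smStep 3 Lc (l +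 1)) (SpureRecAt 3 Lc (toSite r) cE cVH cΛ (l + 1))) (unitM (sfStep Lc (l + 1)) (smStep 3 Lc (l + 1)) (M1At 3 Lc (toSite r) cΛ (l + 1))) 0 (unitM₂ (sfStep Lc (l + 1)) (smStep 3 Lc (l + 1)) (M2Of 3 Lc (mixFFAt (toSite r) Lc) (l + 1)))) κ u κ' u') + cB • vh₂S κ u κ' u') + ε • fun κ u κ' u' => sgnK (trK (((fun κ u κ' u' => (cE₂ * (Lc : ℝ) ^ (2 * (3 + 1))) • mmRead Lc (K3OfK (unitK (sfStep Lc (l + 1)) (smStep 3 Lc (l + 1)) (coDressKBmAt (toSite r) Lc (KInvStep (d := 3) Lc (l + 1)))) Lc (unitS (sfStep Lc (l + 1)) (smStep 3 Lc (l + 1)) (SpureRecAt 3 Lc (toSite r) cE cVH cΛ (l + 1))) (unitM (sfStep Lc (l + 1)) (smStep 3 Lc (l + 1)) (M1At 3 Lc (toSite r) cΛ (l + 1))) (W2SymOfK (unitK (sfStep Lc (l + 1)) (smStep 3 Lc (l + 1)) (coDressKBmAt (toSite r) Lc (KInvStep (d := 3) Lc (l + 1)))) Lc (unitS (sfStep Lc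 (l + 1)) (smStep 3 Lc (l + 1)) (SpureRecAt 3 Lc (toSite r) cE cVH cΛ (l + 1))) (unitM (sfStep Lc (l + 1)) (smStep 3 Lc (l + 1)) (M1At 3 Lc (toSite r) cΛ (l + 1))) 0 (unitM₂ (sfStep Lc (l + 1)) (smStep 3 Lc (l + 1)) (M2Of 3 Lc (mixFFAt (toSite r) Lc) (l + 1)))) κ u κ' u') + cB • vh₂S κ u κ' u')) κ u κ' u')))) κ u κ' u')) - (fun κ u κ' u' => rdiv ((((1 : ℝ) / 2) • ((fun κ u κ' u' => (cE₂ * (Lc : ℝ) ^ (2 * (3 + 1))) • mmRead Lc (K3OfK (unitK (sfStep Lc l) (smStep 3 Lc l) (coDressKBmAt (toSite r) Lc (KInvStep (d := 3) Lc l))) Lc (unitS (sfStep Lc l) (smStep 3 Lc l) (SpureRecAt 3 Lc (toSite r) cE cVH cΛ l)) (unitM (sfStep Lc l) (smStep 3 Lc l) (M1At 3 Lc (toSite r) cΛ l)) (W2SymOfK (unitK (sfStep Lc l) (smStep 3 Lc l) (coDressKBmAt (toSite r) Lc (KInvStep (d := 3) Lc l))) Lc (unitS (sfStep Lc l) (smStep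 3 Lc l) (SpureRecAt 3 Lc (toSite r) cE cVH cΛ l)) (unitM (sfStep Lc l) (smStep 3 Lc l) (M1At 3 Lc (toSite r) cΛ l)) 0 (unitM₂ (sfStep Lc l) (smStep 3 Lc l) (M2Of 3 Lc (mixFFAt (toSite r) Lc) l))) κ u κ' u') + cB • vh₂S κ u κ' u') + ε • fun κ u κ' u' => sgnK (trK (((fun κ u κ' u' => (cE₂ * (Lc : ℝ) ^ (2 * (3 + 1))) • mmRead Lc (K3OfK (unitK (sfStep Lc l) (smStep 3 Lc l) (coDressKBmAt (toSite r) Lc (KInvStep (d := 3) Lc l))) Lc (unitS (sfStep Lc l) (smStep 3 Lc l) (SpureRecAt 3 Lc (toSite r) cE cVH cΛ l)) (unitM (sfStep Lc l) (smStep 3 Lc l) (M1At 3 Lc (toSite r) cΛ l)) (W2SymOfK (unitK (sfStep Lc l) (smStep 3 Lc l) (coDressKBmAt (toSite r) Lc (KInvStep (d := 3) Lc l))) Lc (unitS (sfStep Lc l) (smStep 3 Lc l) (SpureRecAt 3 Lc (toSite r) cE cVH cΛ l)) (unitM (sfStep Lc l) (smStep 3 Lc l) (M1At 3 Lc (toSite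 r) cΛ l)) 0 (unitM₂ (sfStep Lc l) (smStep 3 Lc l) (M2Of 3 Lc (mixFFAt (toSite r) Lc) l))) κ u κ' u') + cB • vh₂S κ u κ' u')) κ u κ' u')))) κ u κ' u'))) (cF * θF ^ l) δS) ∧
      LocStencil₂ (fun κ u κ' u' => rdiv ((((1 : ℝ) / 2) • (unitS₂ (sfStep Lc 0) (smStep 3 Lc 0) (T2RecAt 3 Lc (toSite r) cE cVH cΛ cE₂ cB Tc vh₂S (mixFFAt (toSite r) Lc) 0) + ε • fun κ u κ' u' => sgnK (trK ((unitS₂ (sfStep Lc 0) (smStep 3 Lc 0) (T2RecAt 3 Lc (toSite r) cE cVH cΛ cE₂ cB Tc vh₂S (mixFFAt (toSite r) Lc) 0)) κ u κ' u')))) κ u κ' u')) C₀ δS := by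
  have hLc1 : 1 ≤ Lc := by omega
  obtain ⟨CB, δB, hδB, hBB⟩ := hB
  obtain ⟨Cs, cS, θS, δs, hθS0, hθS1, hδs, hrows⟩ := exists_hS_hSall_SrecAt_three hLc hcE cVH cΛ
  obtain ⟨hS, hSall⟩ := hrows r hr
  obtain ⟨⟨Cb, δb, hδb, hshape⟩, ⟨cb, θb, δb', hcb, hθb0, hθb1, hδb', hcauchy⟩⟩ :=
    source_rows_three_of_srecAt_rows hLc hr cE cVH cΛ cE₂ cB hBB hδB hS hSall hδs hθS0 hθS1
  obtain ⟨Cz, δz, hδz, hz⟩ := exists_locStencil₂_unitS₂_T2RecAt hLc1 hr cE cVH cΛ cE₂ cB Tc ⟨CB, δB, hδB, hBB⟩ 0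
  -- one common rate
  set δS : ℝ := min δb (min δb' δz) with hδSdef
  have hδS : 0 < δS := lt_min hδb (lt_min hδb' hδz)
  have h1 : δS ≤ δb := min_le_left _ _
  have h2 : δS ≤ δb' := (min_le_right _ _).trans (min_le_left _ _)
  have h3 : δS ≤ δz := (min_le_right _ _).trans (min_le_right _ _)
  refine ⟨δS, hδS, ((3 + 1 : ℕ) : ℝ) * (Real.exp δS + 1) * Cb, ((3 + 1 : ℕ) : ℝ) * (Real.exp δS + 1) * cb, θb,
    ((3 + 1 : ℕ) : ℝ) * (Real.exp δS + 1) * Cz, hθb0, hθb1, fun n => ?_, fun l => ?_, ?_⟩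
  · -- (HS): the shape row, halved and right-divergenced
    exact locStencil₂_rdiv (fun κ u κ' u' => (locStencil₂_half ((hshape n).mono h1) hε) κ u κ' u') hδS.le
  · -- (HS′): the drift row — `half_sub` and `rdiv_comp_sub`
    have hc := locStencil₂_rdiv (fun κ u κ' u' => (locStencil₂_half ((hcauchy l 1).mono h2) hε) κ u κ' u') hδS.le
    rw [← rdiv_comp_sub, half_sub]
    exact locStencil₂_mono hc (le_of_eq (by ring))
  · -- (Hx0): the level-0 member
    exact locStencil₂_rdiv (fun κ u κ' u' => (locStencil₂_half (hz.mono h3) hε) κ u κ' u') hδS.le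

end Summit.QuantumFields.BalabanUV.Beta.GAN24.LegSourceRowsThree

end
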